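import Literature.MathematicalPhysics.QuantumFieldTheory.Balaban1983to89.B3Ineq31SmoothLocalization

/-!
# Bałaban, *(Higgs)₂,₃ quantum fields in a finite volume III. Renormalization* [B3] — the norm (1.32) p. 420 of a SMOOTHLY LOCALIZED
# two-variable kernel `(h ⊗ h′)·F`: the multiplier of p. 420 for an ARBITRARY block field `F` (value blocks and derivative blocks), from four
# bounds on the blocks

statement-level skeleton of published theorems with citation tags; proofs where landed; nothing here is a claim about the Yang–Mills mass gap

T. Bałaban, Commun. Math. Phys. **88** (1983) 411–445 [cite: Balaban1983Higgs3].  PDF held: `paper:balaban1983-higgs-2-3-quantum-fields-finite-volume`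
(journal page = PDF page + 410), p. 420 [PDF 10] (`p0010.txt`), p. 424 [PDF 14], p. 432 [PDF 22].

CITATION HEADER (lean-in-tree rule).  Cell `lit-balaban` (HOME `run/shared/lean/pub/lit-balaban/`), Phase-2 proof seat **p33** gen 61 (unit
`lit-balaban-p33`; TAKING line HOME/STATUS.md 2026-08-23T01:51:51Z); SKELETON row **B3.Eq2.5** (fold owner r15; decl of record
`B3Sect2StatementsPart2.ScaledKernels.Ineq25At`), owner item `B3-CLOSURE.md` v1.21 §5 item 14 = the lead's Q7 condition (ii) «the smooth side-2 localization
class of p. 420 applied to δG_k … p40's multiplier … or abstracted once over an arbitrary two-variable block field».  THIS FILE IS THAT ABSTRACTION: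
p40 g69's §III/§III′ of `B3Ineq31SmoothLocalization` (p345208; written on the `G_k(Ω,A)` blocks `blockKR`/`blockDKR`) with the two block families made
PARAMETERS `KV`, `KD`; the companion `B3Ineq25SmoothLocalization` instantiates it on p33 g60's `δG_k(Ω,Ω₂,A)` blocks `blockKD`/`blockDKD`
(`B3Ineq25RegularNested`, p346606).  USED BY NAME, never restated: p40's `IsSmoothLoc`, `dEta`, `fd`, `fo`, `coefA`, `coefB`, the scalar calculus
`abs_coefA_le`/`abs_coefB_le`/`coef_eq_zero`/`abs_coefA_sub_le`/`abs_coefB_sub_le`/`abs_sub_le_lip`, `norm_sandwich_le`, `smoothConst`; p40 g68's product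
lattice `PSite`/`PBd`/`hb`/`dirOf`/`baseOf`/`pdist`/`transp`/`cpath` (`B3Ineq31RegularTorus`); p35's chain transport `hol`; the printed SUM form (1.32)
`B3Sect1Statements.norm132`.

## What is printed (verbatim)

(1.32) p. 420 [PDF 10]: *"‖f‖_{1,α} = sup_x|f(x)| + sup_{x,μ}|(D^η_{B̃,μ}f)(x)| + sup_{x,x′,μ}|x − x′|^{−α}|U(B̃(Γ_{x,x′}))(D^η_{B̃,μ}f)(x′) − (D^η_{B̃,μ}f)(x)|,
(1.32) where Γ_{x,x′} is a shortest contour connecting x and x′. This definition extends in a natural way to functions of many variables."*;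
p. 420: *"For the remaining vertices we localize, taking for each leg of the vector field a smooth partition of unity satisfying the condition that a
support of each function is contained in a cube with sides of length 2."*; after (1.33): *"if in a vertex v there is a leg of external field, then we
multiply it by a smooth function h such that h = 1 on □(v) and h = 0 outside some neighborhood of □(v)"*; (2.5) p. 424: *"‖h(an operator
δG_k(Ω,Ω₂,B̃) or (1.16))h′‖_{1,α} ≤ … where h, h′ are functions giving the localizations of the vertices."*

## What this file proves, and how

THE DATA.  A two-variable kernel on the `ε`-lattice `T_ε` with values in `Hom(ℝ^N, ℝ^N)` is given through its VALUE BLOCKS `KV x y` (the value at the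
point `(x, y)` of the product lattice, read from the differentiated variable `x`: for a column bond the roles of the variables are swapped and the
block is the transposed value) and its DERIVATIVE BLOCKS `KD b y` (the covariant `η`-derivative along the `T_ε`-bond `b` in the differentiated variable at
the other site `y`), both in the print's units.  The instances: p40's `unitV•blockKR`/`unitD•blockDKR` (`F = G_k(Ω,A)`, (3.1)) and p33's
`unitV•blockKD`/`unitD•blockDKD` (`F = δG_k(Ω,Ω₂,A)`, (2.5)).  The LOCALIZED FIELD `G = (h ⊗ h′)F` (`kerM`), its covariant `η`-derivatives BY THE PRODUCT
RULE `D^η(hF)(b) = h(b₊)·(D^ηF)(b) + (∂^ηh)(b)·F(b₋)` times the other localization function (`derivM = coefA•KD + coefB•valM`), and its (1.32) norm on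
the WHOLE product lattice (`normM = norm132` over all sites, all `2d` directions of product bonds, transports `U(A(Γ))∘·∘U(A(Γ′))^*` = `transp`).

THE THEOREMS (p40's §III/§III′ with the blocks abstracted; proofs verbatim).  `holder_core_mulG` — the four-term expansion
`τDG(c′) − DG(c) = a′(τX′ − X) + (a′ − a)X + b′(τY′ − Y) + (b′ − b)Y` with the inside/outside case split, for one same-direction pair in explicit
variables, from the four bounds of the blocks on a pair of domains `(S_b, S_y)` of diameter `≤ m` (values `≤ B`, derivatives `≤ B`, transported Hölder
differences of `KD` `≤ B_H p^α`, transported value moves of `KV` `≤ d(|Δx| + |Δy|)/L^k·B`); `norm_kerM_le`, `norm_derivM_le` (sup parts), `holder_mulM_le`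
(all same-direction pairs), **`normM_le`**: `‖(h ⊗ h′)F‖_{1,α} ≤ (K(c₁,c₂,d,m)·B + B_H)` with p40's `K = smoothConst`, given the eight bounds (the four on
`(S, S′)` and the four on `(S′, S)`); and `isSmoothLoc_of_lip`: a bump of p40's class at exponent `1` (Lipschitz `∂^ηh`, what a `C²` bump gives) is in
the class at every exponent `0 ≤ α ≤ 1` with constant `c₂ + 2c₁` — so that a carrier's localization functions need not depend on `α`.

## Honest scope

Pure lattice algebra: no propagator enters; the four block bounds are hypotheses discharged by the instances ((3.1): p40 p345208; (2.5): the
companion file).  `h, h′` are p40's discrete-smooth bumps supported with collar in `S`, `S′`; only the DIAMETER bound `≤ mL^k` of the two domains is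
used here (no separation, no interior condition — those enter the block bounds).  No `def … : Prop`, no named fact (`kerM`, `valM`, `derivM`, `normM`
are concrete data); axioms standard.  Value = the reusable multiplier step of the localization-function reading of (2.5)/(3.1), NOT summit progress.
-/

noncomputable section

open scoped BigOperators InnerProductSpace Matrix

namespace Literature.MathematicalPhysics.QuantumFieldTheory.Balaban1983to89.B3Norm132SmoothMultiplier

open HiggsLattice (ChargeData)
open HiggsCovariance (E)
open B1Ineq234Concrete (tdist_self)
open B1Ineq234LevelZero (tdist_comm)
open B1TorusChainTransport (hol)
open B3Sect1Statements (norm132)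
open LatticeNorms (supNorm_le holderSeminorm_le)
open B3Ineq211RegularTorus (one_le_tdist_of_ne')
open B3Ineq31RegularTorus (cpath PSite PBd hb dirOf baseOf pdist transp norm_hol_comp_le)
open B3Ineq31SmoothLocalization (dEta IsSmoothLoc fd fo coefA coefB abs_coefA_le abs_coefB_le coef_eq_zero abs_coefA_sub_le
  abs_coefB_sub_le norm_sandwich_le smoothConst smoothConst_pos)

variable {P : HiggsLattice.Params} {N : ℕ}

/-! ## §0 Scalar kernels -/

section Scalar

/-- the two-regime trick: a quantity bounded by `K₁p` AND by `K₂` is `≤ (K₁ + K₂)p^α` for `p > 0`, `0 ≤ α ≤ 1`. [folklore] -/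
private theorem le_add_mul_rpow {t p α K₁ K₂ : ℝ} (hp : 0 < p) (hα0 : 0 ≤ α) (hα1 : α ≤ 1) (hK₁ : 0 ≤ K₁) (hK₂ : 0 ≤ K₂)
    (h₁ : t ≤ K₁ * p) (h₂ : t ≤ K₂) : t ≤ (K₁ + K₂) * p ^ α := by
  have hpα0 : 0 ≤ p ^ α := Real.rpow_nonneg hp.le α
  rcases le_total p 1 with hp1 | hp1
  · have hpα : p ≤ p ^ α := by
      conv_lhs => rw [← Real.rpow_one p]
      exact Real.rpow_le_rpow_of_exponent_ge hp hp1 hα1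
    calc t ≤ K₁ * p := h₁
      _ ≤ K₁ * p ^ α := mul_le_mul_of_nonneg_left hpα hK₁
      _ ≤ (K₁ + K₂) * p ^ α := by rw [add_mul]; linarith [mul_nonneg hK₂ hpα0]
  · have hpα : 1 ≤ p ^ α := Real.one_le_rpow hp1 hα0
    calc t ≤ K₂ * 1 := by rw [mul_one]; exact h₂
      _ ≤ K₂ * p ^ α := mul_le_mul_of_nonneg_left hpα hK₂
      _ ≤ (K₁ + K₂) * p ^ α := by rw [add_mul]; linarith [mul_nonneg hK₁ hpα0]

/-- inside a domain of diameter `≤ m`: `p ≤ m·p^α` for `0 < p ≤ m`, `0 ≤ α ≤ 1`. [folklore] -/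
private theorem le_mul_rpow_of_le {p α : ℝ} {m : ℕ} (hp : 0 < p) (hpm : p ≤ m) (hα0 : 0 ≤ α) (hα1 : α ≤ 1) : p ≤ m * p ^ α := by
  have hm1 : (1 : ℝ) ≤ m := by
    have : (0 : ℝ) < m := hp.trans_le hpm
    exact_mod_cast Nat.one_le_iff_ne_zero.mpr (by rintro rfl; simp at this)
  have e : p = p ^ α * p ^ (1 - α) := by
    rw [← Real.rpow_add hp, add_sub_cancel, Real.rpow_one]
  have h1 : p ^ (1 - α) ≤ (m : ℝ) ^ (1 - α) := Real.rpow_le_rpow hp.le hpm (by linarith)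
  have h2 : (m : ℝ) ^ (1 - α) ≤ (m : ℝ) ^ (1 : ℝ) := Real.rpow_le_rpow_of_exponent_le hm1 (by linarith)
  rw [Real.rpow_one] at h2
  calc p = p ^ α * p ^ (1 - α) := e
    _ ≤ p ^ α * m := mul_le_mul_of_nonneg_left (h1.trans h2) (Real.rpow_nonneg hp.le _)
    _ = m * p ^ α := mul_comm _ _

/-- the four-term identity `a′X̃′ + b′Ỹ′ − (aX + bY) = a′(X̃′ − X) + (a′ − a)X + b′(Ỹ′ − Y) + (b′ − b)Y`. [folklore] -/
private theorem four_term {M : Type*} [AddCommGroup M] [Module ℝ M] (r r' s s' : ℝ) (X Y TX TY : M) :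
    r' • TX + s' • TY - (r • X + s • Y) = r' • (TX - X) + (r' - r) • X + s' • (TY - Y) + (s' - s) • Y := by
  simp only [smul_sub, sub_smul]; abel

/-- `‖aX + bY + cZ + dW‖ ≤ |a|‖X‖ + |b|‖Y‖ + |c|‖Z‖ + |d|‖W‖`. [folklore] -/
private theorem norm_four_le (r s t u : ℝ) (X Y Z W : E N →L[ℝ] E N) :
    ‖r • X + s • Y + t • Z + u • W‖ ≤ |r| * ‖X‖ + |s| * ‖Y‖ + |t| * ‖Z‖ + |u| * ‖W‖ := by
  have h := norm_add_le (r • X + s • Y + t • Z) (u • W)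
  have h' := norm_add_le (r • X + s • Y) (t • Z)
  have h'' := norm_add_le (r • X) (s • Y)
  simp only [norm_smul, Real.norm_eq_abs] at h h' h''
  linarith

end Scalar

/-! ## §1 The localization class at exponent `1` lies in the class at every exponent `0 ≤ α ≤ 1` -/

section LipClass

variable {k : ℕ}

/-- **A bump with Lipschitz `η`-derivative is `α`-Hölder for every `0 ≤ α ≤ 1`**: if `h` is in p40's class `IsSmoothLoc k c₁ c₂ 1 S` (`|h| ≤ 1`,
`|∂^ηh| ≤ c₁`, `|∂^η_μh(x′) − ∂^η_μh(x)| ≤ c₂|x − x′|/L^k`, collar in `S`) — what the lattice sees of a `C²` bump of p. 420 in the `η`-units — then it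
is in `IsSmoothLoc k c₁ (c₂ + 2c₁) α S` (the difference of two `η`-derivatives is also `≤ 2c₁` outright; two regimes).  This lets a carrier of (2.5)
take ONE class of localization functions for all `α`. [cite: Balaban1983Higgs3, p.420] [cite: Balaban1983Higgs3, (1.32) p.420] -/
theorem isSmoothLoc_of_lip {c₁ c₂ α : ℝ} (hc₁ : 0 ≤ c₁) (hc₂ : 0 ≤ c₂) (hα0 : 0 ≤ α) (hα1 : α ≤ 1)
    {S : Finset (HiggsLattice.Site P 0)} {h : HiggsLattice.Site P 0 → ℝ} (hh : IsSmoothLoc k c₁ c₂ 1 S h) :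
    IsSmoothLoc k c₁ (c₂ + 2 * c₁) α S h where
  abs_le := hh.abs_le
  dEta_le := hh.dEta_le
  collar := hh.collar
  holder := by
    intro μ x x'
    have hLk : (0 : ℝ) < (P.L : ℝ) ^ k := pow_pos (by exact_mod_cast P.hL) k
    by_cases hx : x' = x
    · subst hx
      rw [sub_self, abs_zero]
      exact mul_nonneg (by positivity) (Real.rpow_nonneg (by positivity) _)
    have hp : 0 < (HiggsLattice.Site.tdist x x' : ℝ) / (P.L : ℝ) ^ k := by
      have h1 : (1 : ℝ) ≤ (HiggsLattice.Site.tdist x x' : ℝ) := by exact_mod_cast one_le_tdist_of_ne' hx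
      positivity
    refine le_add_mul_rpow hp hα0 hα1 hc₂ (by positivity) ?_ ?_
    · have := hh.holder μ x x'
      rwa [Real.rpow_one] at this
    · calc |dEta k h ⟨x', μ⟩ - dEta k h ⟨x, μ⟩| ≤ |dEta k h ⟨x', μ⟩| + |dEta k h ⟨x, μ⟩| := abs_sub _ _
        _ ≤ c₁ + c₁ := add_le_add (hh.dEta_le _) (hh.dEta_le _)
        _ = 2 * c₁ := by ring

end LipClass

/-! ## §2 The multiplier core for an abstract block pair: one same-direction pair in explicit variables -/

section Core

variable {C : ChargeData N} {A : HiggsLattice.VecField P 0} {k m : ℕ}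
  {KV : HiggsLattice.Site P 0 → HiggsLattice.Site P 0 → (E N →L[ℝ] E N)}
  {KD : HiggsLattice.PBond P 0 → HiggsLattice.Site P 0 → (E N →L[ℝ] E N)}

/-- **The core Hölder estimate for the multiplier, one same-direction pair in explicit variables, ABSTRACT BLOCKS.**  On a pair of domains
`(S_b, S_y)` of diameter `≤ mL^k` carrying smooth localization functions `g_b` (differentiated variable) and `g_y` (other variable), given the four
bounds of the UNLOCALIZED blocks on the pair — values `‖KV x y‖ ≤ B`, derivatives `‖KD ⟨x,μ⟩ y‖ ≤ B`, transported Hölder differences of `KD`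
`≤ B_H·p^α`, transported value moves of `KV` `≤ d(|Δx| + |Δy|)/L^k·B` — the transported difference of `D^η(g_b F g_y) = a·KD + b·KV`
(`a = g_y(y)g_b(x+e_μ)`, `b = g_y(y)∂^η_μg_b(x)`) between the bonds over `(x₁,y₁)` and `(x₂,y₂)` is at most
`(B_H + (4 + 2dc₁ + 2dmc₁ + dc₁² + 2c₁ + c₂)·B)·p^α`, `p = max(|x₁−x₂|,|y₁−y₂|)/L^k > 0`, WHETHER OR NOT the bonds lie in the domains (four-term
expansion inside; vanishing far coefficients when one is outside; trivial when both are) — p40's `holder_core_mul` with the blocks abstracted.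
[cite: Balaban1983Higgs3, (1.32) p.420] [cite: Balaban1983Higgs3, (2.5) p.424, (3.1) p.432] -/
theorem holder_core_mulG {Sb Sy : Finset (HiggsLattice.Site P 0)}
    (hdiam : ∀ y₁ ∈ Sb, ∀ y₂ ∈ Sb, (HiggsLattice.Site.tdist y₁ y₂ : ℝ) / (P.L : ℝ) ^ k ≤ m)
    (hdiam' : ∀ y₁ ∈ Sy, ∀ y₂ ∈ Sy, (HiggsLattice.Site.tdist y₁ y₂ : ℝ) / (P.L : ℝ) ^ k ≤ m)
    {c₁ c₂ α : ℝ} (hc₁ : 0 ≤ c₁) (hc₂ : 0 ≤ c₂) (hα0 : 0 ≤ α) (hα1 : α ≤ 1) {gB gY : HiggsLattice.Site P 0 → ℝ}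
    (hgB : IsSmoothLoc k c₁ c₂ α Sb gB) (hgY : IsSmoothLoc k c₁ c₂ α Sy gY) {BV BH : ℝ} (hBV : 0 ≤ BV) (hBH : 0 ≤ BH)
    (bY : ∀ x ∈ Sb, ∀ y ∈ Sy, ‖KV x y‖ ≤ BV)
    (bX : ∀ x ∈ Sb, ∀ y ∈ Sy, ∀ μ : Fin P.d, ‖KD ⟨x, μ⟩ y‖ ≤ BV)
    (bH : ∀ (μ : Fin P.d) (x₁ x₂ y₁ y₂ : HiggsLattice.Site P 0), x₁ ∈ Sb → x₂ ∈ Sb → y₁ ∈ Sy → y₂ ∈ Sy →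
      0 < max (HiggsLattice.Site.tdist x₁ x₂ : ℝ) (HiggsLattice.Site.tdist y₁ y₂ : ℝ) / (P.L : ℝ) ^ k →
      ‖(hol C A x₁ (cpath x₁ x₂)).comp ((KD ⟨x₂, μ⟩ y₂).comp (star (hol C A y₁ (cpath y₁ y₂)))) - KD ⟨x₁, μ⟩ y₁‖
        ≤ BH * (max (HiggsLattice.Site.tdist x₁ x₂ : ℝ) (HiggsLattice.Site.tdist y₁ y₂ : ℝ) / (P.L : ℝ) ^ k) ^ α)
    (bM : ∀ (x₁ x₂ y₁ y₂ : HiggsLattice.Site P 0), x₁ ∈ Sb → x₂ ∈ Sb → y₁ ∈ Sy → y₂ ∈ Sy →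
      ‖(hol C A x₁ (cpath x₁ x₂)).comp ((KV x₂ y₂).comp (star (hol C A y₁ (cpath y₁ y₂)))) - KV x₁ y₁‖
        ≤ (P.d : ℝ) * (((HiggsLattice.Site.tdist x₁ x₂ : ℝ) + (HiggsLattice.Site.tdist y₁ y₂ : ℝ)) / (P.L : ℝ) ^ k) * BV)
    {x₁ x₂ y₁ y₂ : HiggsLattice.Site P 0} (μ : Fin P.d)
    (hpos : 0 < max (HiggsLattice.Site.tdist x₁ x₂ : ℝ) (HiggsLattice.Site.tdist y₁ y₂ : ℝ) / (P.L : ℝ) ^ k) :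
    ‖(hol C A x₁ (cpath x₁ x₂)).comp
          (((gY y₂ * gB (x₂.shift μ)) • KD ⟨x₂, μ⟩ y₂ + (gY y₂ * dEta k gB ⟨x₂, μ⟩) • KV x₂ y₂).comp
            (star (hol C A y₁ (cpath y₁ y₂))))
        - ((gY y₁ * gB (x₁.shift μ)) • KD ⟨x₁, μ⟩ y₁ + (gY y₁ * dEta k gB ⟨x₁, μ⟩) • KV x₁ y₁)‖
      ≤ (BH + ((2 * P.d * c₁ + 2) + 2 * P.d * m * c₁ + (c₂ + P.d * c₁ * c₁ + 2 * c₁)) * BV) *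
          (max (HiggsLattice.Site.tdist x₁ x₂ : ℝ) (HiggsLattice.Site.tdist y₁ y₂ : ℝ) / (P.L : ℝ) ^ k) ^ α := by
  have hLk : (0 : ℝ) < (P.L : ℝ) ^ k := pow_pos (by exact_mod_cast P.hL) k
  -- the coefficient facts (before renaming)
  have ha' : |gY y₂ * gB (x₂.shift μ)| ≤ 1 := abs_coefA_le hgB hgY y₂ _
  have ha : |gY y₁ * gB (x₁.shift μ)| ≤ 1 := abs_coefA_le hgB hgY y₁ _
  have hb' : |gY y₂ * dEta k gB ⟨x₂, μ⟩| ≤ c₁ := abs_coefB_le hgB hgY y₂ _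
  have hb : |gY y₁ * dEta k gB ⟨x₁, μ⟩| ≤ c₁ := abs_coefB_le hgB hgY y₁ _
  have hda := abs_coefA_sub_le hgB hgY hc₁ hα0 hα1 μ hpos (x₁ := x₁) (x₂ := x₂) (y₁ := y₁) (y₂ := y₂)
  have hdb := abs_coefB_sub_le hgB hgY hc₁ hc₂ hα0 hα1 μ hpos (x₁ := x₁) (x₂ := x₂) (y₁ := y₁) (y₂ := y₂)
  have hza' := fun hc => (coef_eq_zero hgB hgY (x := x₂) (y := y₂) (μ := μ) hc).1
  have hzb' := fun hc => (coef_eq_zero hgB hgY (x := x₂) (y := y₂) (μ := μ) hc).2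
  have hza := fun hc => (coef_eq_zero hgB hgY (x := x₁) (y := y₁) (μ := μ) hc).1
  have hzb := fun hc => (coef_eq_zero hgB hgY (x := x₁) (y := y₁) (μ := μ) hc).2
  -- names
  set pd := max (HiggsLattice.Site.tdist x₁ x₂ : ℝ) (HiggsLattice.Site.tdist y₁ y₂ : ℝ) / (P.L : ℝ) ^ k with hpd
  have hpdα : 0 ≤ pd ^ α := Real.rpow_nonneg hpos.le α
  generalize ea' : gY y₂ * gB (x₂.shift μ) = a₂ at ha' hda hza'
  generalize ea : gY y₁ * gB (x₁.shift μ) = a₁ at ha hda hza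
  generalize eb' : gY y₂ * dEta k gB ⟨x₂, μ⟩ = b₂ at hb' hdb hzb'
  generalize eb : gY y₁ * dEta k gB ⟨x₁, μ⟩ = b₁ at hb hdb hzb
  generalize eX' : KD ⟨x₂, μ⟩ y₂ = X'
  generalize eX : KD ⟨x₁, μ⟩ y₁ = X
  generalize eY' : KV x₂ y₂ = Y'
  generalize eY : KV x₁ y₁ = Y
  -- the transported atoms, and the transports distributed over the linear combination
  obtain ⟨TX, eTX⟩ : ∃ T : E N →L[ℝ] E N,
      (hol C A x₁ (cpath x₁ x₂)).comp (X'.comp (star (hol C A y₁ (cpath y₁ y₂)))) = T := ⟨_, rfl⟩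
  obtain ⟨TY, eTY⟩ : ∃ T : E N →L[ℝ] E N,
      (hol C A x₁ (cpath x₁ x₂)).comp (Y'.comp (star (hol C A y₁ (cpath y₁ y₂)))) = T := ⟨_, rfl⟩
  have hTX : ‖TX‖ ≤ ‖X'‖ := by rw [← eTX]; exact norm_sandwich_le _ _ _ _ _
  have hTY : ‖TY‖ ≤ ‖Y'‖ := by rw [← eTY]; exact norm_sandwich_le _ _ _ _ _
  have edist : (hol C A x₁ (cpath x₁ x₂)).comp ((a₂ • X' + b₂ • Y').comp (star (hol C A y₁ (cpath y₁ y₂)))) = a₂ • TX + b₂ • TY := by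
    rw [← eTX, ← eTY]
    simp only [ContinuousLinearMap.add_comp, ContinuousLinearMap.smul_comp, ContinuousLinearMap.comp_add,
      ContinuousLinearMap.comp_smul]
  rw [edist]
  -- the total constant dominates the partial ones
  have hpart : ((2 * P.d * c₁ + 2) + (c₂ + P.d * c₁ * c₁ + 2 * c₁)) * BV * pd ^ α
      ≤ (BH + ((2 * P.d * c₁ + 2) + 2 * P.d * m * c₁ + (c₂ + P.d * c₁ * c₁ + 2 * c₁)) * BV) * pd ^ α := by
    refine mul_le_mul_of_nonneg_right ?_ hpdα
    nlinarith [mul_nonneg (mul_nonneg (mul_nonneg (mul_nonneg (by norm_num : (0 : ℝ) ≤ 2) (Nat.cast_nonneg P.d))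
      (Nat.cast_nonneg m)) hc₁) hBV]
  by_cases hc : x₁ ∈ Sb ∧ y₁ ∈ Sy ∧ x₁.shift μ ∈ Sb <;> by_cases hc' : x₂ ∈ Sb ∧ y₂ ∈ Sy ∧ x₂.shift μ ∈ Sb
  · -- both bonds inside: the four-term expansion
    obtain ⟨hx₁, hy₁, -⟩ := hc
    obtain ⟨hx₂, hy₂, -⟩ := hc'
    have h1 : ‖TX - X‖ ≤ BH * pd ^ α := by rw [← eTX, ← eX, ← eX']; exact bH μ x₁ x₂ y₁ y₂ hx₁ hx₂ hy₁ hy₂ hpos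
    have h2 : ‖X‖ ≤ BV := by rw [← eX]; exact bX x₁ hx₁ y₁ hy₁ μ
    have h4 : ‖Y‖ ≤ BV := by rw [← eY]; exact bY x₁ hx₁ y₁ hy₁
    have hpdm : pd ≤ m := by
      rw [hpd, ← max_div_div_right hLk.le]
      exact max_le (hdiam x₁ hx₁ x₂ hx₂) (hdiam' y₁ hy₁ y₂ hy₂)
    have hpdmα : pd ≤ m * pd ^ α := le_mul_rpow_of_le hpos hpdm hα0 hα1
    have h3 : ‖TY - Y‖ ≤ 2 * P.d * m * BV * pd ^ α := by
      rw [← eTY, ← eY, ← eY']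
      refine (bM x₁ x₂ y₁ y₂ hx₁ hx₂ hy₁ hy₂).trans ?_
      have hsum : ((HiggsLattice.Site.tdist x₁ x₂ : ℝ) + (HiggsLattice.Site.tdist y₁ y₂ : ℝ)) / (P.L : ℝ) ^ k ≤ 2 * pd := by
        rw [add_div]
        have e1 : (HiggsLattice.Site.tdist x₁ x₂ : ℝ) / (P.L : ℝ) ^ k ≤ pd := div_le_div_of_nonneg_right (le_max_left _ _) hLk.le
        have e2 : (HiggsLattice.Site.tdist y₁ y₂ : ℝ) / (P.L : ℝ) ^ k ≤ pd := div_le_div_of_nonneg_right (le_max_right _ _) hLk.le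
        linarith
      calc (P.d : ℝ) * (((HiggsLattice.Site.tdist x₁ x₂ : ℝ) + (HiggsLattice.Site.tdist y₁ y₂ : ℝ)) / (P.L : ℝ) ^ k) * BV
          ≤ (P.d : ℝ) * (2 * (m * pd ^ α)) * BV :=
            mul_le_mul_of_nonneg_right (mul_le_mul_of_nonneg_left (hsum.trans (by linarith)) (Nat.cast_nonneg _)) hBV
        _ = _ := by ring
    have e4 : a₂ • TX + b₂ • TY - (a₁ • X + b₁ • Y) = a₂ • (TX - X) + (a₂ - a₁) • X + b₂ • (TY - Y) + (b₂ - b₁) • Y :=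
      four_term _ _ _ _ _ _ _ _
    rw [e4]
    refine (norm_four_le _ _ _ _ _ _ _ _).trans ?_
    calc |a₂| * ‖TX - X‖ + |a₂ - a₁| * ‖X‖ + |b₂| * ‖TY - Y‖ + |b₂ - b₁| * ‖Y‖
        ≤ 1 * (BH * pd ^ α) + (2 * P.d * c₁ + 2) * pd ^ α * BV + c₁ * (2 * P.d * m * BV * pd ^ α)
            + (c₂ + P.d * c₁ * c₁ + 2 * c₁) * pd ^ α * BV := by
          refine add_le_add (add_le_add (add_le_add ?_ ?_) ?_) ?_
          · exact mul_le_mul ha' h1 (norm_nonneg _) zero_le_one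
          · exact mul_le_mul hda h2 (norm_nonneg _) (by positivity)
          · exact mul_le_mul hb' h3 (norm_nonneg _) hc₁
          · exact mul_le_mul hdb h4 (norm_nonneg _) (by positivity)
      _ = _ := by ring
  · -- `c` inside, `c′` outside: `a′ = b′ = 0`, and `|a| = |a′ − a|`, `|b| = |b′ − b|`
    obtain ⟨hx₁, hy₁, -⟩ := hc
    have h2 : ‖X‖ ≤ BV := by rw [← eX]; exact bX x₁ hx₁ y₁ hy₁ μ
    have h4 : ‖Y‖ ≤ BV := by rw [← eY]; exact bY x₁ hx₁ y₁ hy₁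
    have ea0 : a₂ = 0 := hza' hc'
    have eb0 : b₂ = 0 := hzb' hc'
    subst ea0 eb0
    rw [zero_smul ℝ TX, zero_smul ℝ TY, zero_add, zero_sub, norm_neg]
    rw [zero_sub, abs_neg] at hda hdb
    calc ‖a₁ • X + b₁ • Y‖ ≤ |a₁| * ‖X‖ + |b₁| * ‖Y‖ := by
          refine (norm_add_le _ _).trans ?_; rw [norm_smul, norm_smul, Real.norm_eq_abs, Real.norm_eq_abs]
      _ ≤ (2 * P.d * c₁ + 2) * pd ^ α * BV + (c₂ + P.d * c₁ * c₁ + 2 * c₁) * pd ^ α * BV :=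
          add_le_add (mul_le_mul hda h2 (norm_nonneg _) (by positivity)) (mul_le_mul hdb h4 (norm_nonneg _) (by positivity))
      _ = ((2 * P.d * c₁ + 2) + (c₂ + P.d * c₁ * c₁ + 2 * c₁)) * BV * pd ^ α := by ring
      _ ≤ _ := hpart
  · -- `c` outside, `c′` inside: `a = b = 0`
    obtain ⟨hx₂, hy₂, -⟩ := hc'
    have h2 : ‖TX‖ ≤ BV := hTX.trans (by rw [← eX']; exact bX x₂ hx₂ y₂ hy₂ μ)
    have h4 : ‖TY‖ ≤ BV := hTY.trans (by rw [← eY']; exact bY x₂ hx₂ y₂ hy₂)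
    have ea0 : a₁ = 0 := hza hc
    have eb0 : b₁ = 0 := hzb hc
    subst ea0 eb0
    rw [zero_smul ℝ X, zero_smul ℝ Y, add_zero, sub_zero]
    rw [sub_zero] at hda hdb
    calc ‖a₂ • TX + b₂ • TY‖ ≤ |a₂| * ‖TX‖ + |b₂| * ‖TY‖ := by
          refine (norm_add_le _ _).trans ?_; rw [norm_smul, norm_smul, Real.norm_eq_abs, Real.norm_eq_abs]
      _ ≤ (2 * P.d * c₁ + 2) * pd ^ α * BV + (c₂ + P.d * c₁ * c₁ + 2 * c₁) * pd ^ α * BV :=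
          add_le_add (mul_le_mul hda h2 (norm_nonneg _) (by positivity)) (mul_le_mul hdb h4 (norm_nonneg _) (by positivity))
      _ = ((2 * P.d * c₁ + 2) + (c₂ + P.d * c₁ * c₁ + 2 * c₁)) * BV * pd ^ α := by ring
      _ ≤ _ := hpart
  · -- both outside: everything vanishes
    have ea0 : a₁ = 0 := hza hc
    have eb0 : b₁ = 0 := hzb hc
    have ea0' : a₂ = 0 := hza' hc'
    have eb0' : b₂ = 0 := hzb' hc'
    subst ea0 eb0 ea0' eb0'
    rw [zero_smul ℝ TX, zero_smul ℝ TY, zero_smul ℝ X, zero_smul ℝ Y, add_zero, sub_self, norm_zero]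
    positivity

end Core

/-! ## §3 The localized field `(h ⊗ h′)F` of an abstract block pair, its derivatives by the product rule, its (1.32) norm -/

section Product

variable (C : ChargeData N) (A : HiggsLattice.VecField P 0) (k : ℕ)
  (KV : HiggsLattice.Site P 0 → HiggsLattice.Site P 0 → (E N →L[ℝ] E N))
  (KD : HiggsLattice.PBond P 0 → HiggsLattice.Site P 0 → (E N →L[ℝ] E N))

/-- **The localized two-variable field** `G(x,x′) = h(x)h′(x′)·F(x,x′)` of an abstract block field (`KV` read at the point of the product lattice),
on the whole product lattice. [cite: Balaban1983Higgs3, p.420] [cite: Balaban1983Higgs3, (2.5) p.424, (3.1) p.432] -/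
def kerM (h h' : HiggsLattice.Site P 0 → ℝ) (z : PSite P) : E N →L[ℝ] E N := (h z.1 * h' z.2) • KV z.1 z.2

/-- **The value the field carries at the base of a product bond, seen from the differentiated variable**: `KV x x′` for the row bond over `(x,x′)`,
the (transposed) value `KV x′ x` for the column bond. [cite: Balaban1983Higgs3, (1.32) p.420] -/
def valM (c : PBd P) : E N →L[ℝ] E N := KV (hb c).1.src (hb c).2

/-- **The covariant `η`-derivatives of `G = (h ⊗ h′)F` along the product bonds, BY THE PRODUCT RULE**
`D^η(hF)(b) = h(b₊)·(D^ηF)(b) + (∂^ηh)(b)·F(b₋)` in the differentiated variable, times the localization function of the other variable: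
`a(c)·KD + b(c)·KV` with p40's coefficients `coefA`, `coefB`. [cite: Balaban1983Higgs3, (1.32) p.420] [cite: Balaban1982Higgs1, (1.7) p.605] -/
def derivM (h h' : HiggsLattice.Site P 0 → ℝ) (c : PBd P) : E N →L[ℝ] E N :=
  coefA h h' c • KD (hb c).1 (hb c).2 + coefB k h h' c • valM KV c

/-- **The printed (1.32) norm of `(h ⊗ h′)F` on THE WHOLE PRODUCT LATTICE**: `norm132` over all sites, all product bonds, same-direction pairs at the
sup-distance `pdist`, transports `U(A(Γ))∘·∘U(A(Γ′))^*` (`transp`). [cite: Balaban1983Higgs3, (1.32) p.420] [cite: Balaban1983Higgs3, (2.5) p.424] -/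
def normM (α : ℝ) (h h' : HiggsLattice.Site P 0 → ℝ) : ℝ :=
  norm132 α (fun c c' : PBd P => dirOf c = dirOf c') (fun c c' => pdist k (baseOf c) (baseOf c')) (transp C A)
    Finset.univ Finset.univ (kerM KV h h') (derivM k KV KD h h')

variable {C A k KV KD}

/-- `normM` unfolds to the printed sum form. [cite: Balaban1983Higgs3, (1.32) p.420] -/
theorem normM_eq (α : ℝ) (h h' : HiggsLattice.Site P 0 → ℝ) :
    normM C A k KV KD α h h'
      = norm132 α (fun c c' : PBd P => dirOf c = dirOf c') (fun c c' => pdist k (baseOf c) (baseOf c')) (transp C A)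
          Finset.univ Finset.univ (kerM KV h h') (derivM k KV KD h h') :=
  rfl

/-- `derivM` on a ROW bond `μ` over `(x,x′)`: `h′(x′)h(x+e_μ)·KD ⟨x,μ⟩ x′ + h′(x′)(∂^η_μh)(x)·KV x x′`. [cite: Balaban1983Higgs3, (1.32) p.420] -/
theorem derivM_inl (h h' : HiggsLattice.Site P 0 → ℝ) (μ : Fin P.d) (x x' : HiggsLattice.Site P 0) :
    derivM k KV KD h h' (Sum.inl (μ, (x, x')))
      = (h' x' * h (x.shift μ)) • KD ⟨x, μ⟩ x' + (h' x' * dEta k h ⟨x, μ⟩) • KV x x' := by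
  simp only [derivM, coefA, coefB, valM, fd, fo, hb, Sum.elim_inl, HiggsLattice.PBond.tgt]

/-- `derivM` on a COLUMN bond `ν` over `(x,x′)`: `h(x)h′(x′+e_ν)·KD ⟨x′,ν⟩ x + h(x)(∂^η_νh′)(x′)·KV x′ x`. [cite: Balaban1983Higgs3, (1.32) p.420] -/
theorem derivM_inr (h h' : HiggsLattice.Site P 0 → ℝ) (ν : Fin P.d) (x x' : HiggsLattice.Site P 0) :
    derivM k KV KD h h' (Sum.inr (ν, (x, x')))
      = (h x * h' (x'.shift ν)) • KD ⟨x', ν⟩ x + (h x * dEta k h' ⟨x', ν⟩) • KV x' x := by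
  simp only [derivM, coefA, coefB, valM, fd, fo, hb, Sum.elim_inr, HiggsLattice.PBond.tgt]

variable {m : ℕ}

/-- `G` vanishes unless both arguments lie in the supports, and then `‖G(x,x′)‖ ≤ ‖F(x,x′)‖ ≤ B` (`|hh′| ≤ 1`).
[cite: Balaban1983Higgs3, (2.5) p.424, (3.1) p.432] -/
theorem norm_kerM_le {S S' : Finset (HiggsLattice.Site P 0)} {c₁ c₂ α : ℝ} {h h' : HiggsLattice.Site P 0 → ℝ}
    (hh : IsSmoothLoc k c₁ c₂ α S h) (hh' : IsSmoothLoc k c₁ c₂ α S' h') {BV : ℝ} (hBV : 0 ≤ BV)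
    (bY : ∀ x ∈ S, ∀ y ∈ S', ‖KV x y‖ ≤ BV) (z : PSite P) :
    ‖kerM KV h h' z‖ ≤ BV := by
  rw [kerM, norm_smul, Real.norm_eq_abs]
  by_cases h1 : h z.1 = 0
  · rw [h1, zero_mul, abs_zero, zero_mul]; exact hBV
  by_cases h2 : h' z.2 = 0
  · rw [h2, mul_zero, abs_zero, zero_mul]; exact hBV
  have hprod : |h z.1 * h' z.2| ≤ 1 := by
    rw [abs_mul]; nlinarith [abs_nonneg (h z.1), abs_nonneg (h' z.2), hh.abs_le z.1, hh'.abs_le z.2]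
  have hF : ‖KV z.1 z.2‖ ≤ BV := bY z.1 (hh.collar _ h1).1 z.2 (hh'.collar _ h2).1
  calc |h z.1 * h' z.2| * ‖KV z.1 z.2‖ ≤ 1 * BV := mul_le_mul hprod hF (norm_nonneg _) zero_le_one
    _ = BV := one_mul _

/-- the derivative bound in explicit variables: `‖a·KD + b·KV‖ ≤ (1 + c₁)B` on bonds inside, `0` outside. [cite: Balaban1983Higgs3, (2.5) p.424, (3.1) p.432] -/
theorem norm_derivM_core {Sb Sy : Finset (HiggsLattice.Site P 0)} {c₁ c₂ α : ℝ} (hc₁ : 0 ≤ c₁) {gB gY : HiggsLattice.Site P 0 → ℝ}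
    (hgB : IsSmoothLoc k c₁ c₂ α Sb gB) (hgY : IsSmoothLoc k c₁ c₂ α Sy gY) {BV : ℝ} (hBV : 0 ≤ BV)
    (bY : ∀ x ∈ Sb, ∀ y ∈ Sy, ‖KV x y‖ ≤ BV) (bX : ∀ x ∈ Sb, ∀ y ∈ Sy, ∀ μ : Fin P.d, ‖KD ⟨x, μ⟩ y‖ ≤ BV)
    (x y : HiggsLattice.Site P 0) (μ : Fin P.d) :
    ‖(gY y * gB (x.shift μ)) • KD ⟨x, μ⟩ y + (gY y * dEta k gB ⟨x, μ⟩) • KV x y‖ ≤ (1 + c₁) * BV := by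
  obtain ⟨X, eX⟩ : ∃ T : E N →L[ℝ] E N, KD ⟨x, μ⟩ y = T := ⟨_, rfl⟩
  obtain ⟨Y, eY⟩ : ∃ T : E N →L[ℝ] E N, KV x y = T := ⟨_, rfl⟩
  rw [eX, eY]
  by_cases hc : x ∈ Sb ∧ y ∈ Sy ∧ x.shift μ ∈ Sb
  · obtain ⟨hx, hy, -⟩ := hc
    have h2 : ‖X‖ ≤ BV := by rw [← eX]; exact bX x hx y hy μ
    have h4 : ‖Y‖ ≤ BV := by rw [← eY]; exact bY x hx y hy
    calc ‖(gY y * gB (x.shift μ)) • X + (gY y * dEta k gB ⟨x, μ⟩) • Y‖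
        ≤ |gY y * gB (x.shift μ)| * ‖X‖ + |gY y * dEta k gB ⟨x, μ⟩| * ‖Y‖ := by
          refine (norm_add_le _ _).trans ?_; rw [norm_smul, norm_smul, Real.norm_eq_abs, Real.norm_eq_abs]
      _ ≤ 1 * BV + c₁ * BV :=
          add_le_add (mul_le_mul (abs_coefA_le hgB hgY y _) h2 (norm_nonneg _) zero_le_one)
            (mul_le_mul (abs_coefB_le hgB hgY y _) h4 (norm_nonneg _) hc₁)
      _ = (1 + c₁) * BV := by ring
  · obtain ⟨h0, h0'⟩ := coef_eq_zero hgB hgY hc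
    rw [h0, h0', zero_smul ℝ X, zero_smul ℝ Y, add_zero, norm_zero]
    positivity

/-- **`‖D^ηG(c)‖ ≤ (1 + c₁)·B` on every product bond** (row and column). [cite: Balaban1983Higgs3, (2.5) p.424, (3.1) p.432] -/
theorem norm_derivM_le {S S' : Finset (HiggsLattice.Site P 0)} {c₁ c₂ α : ℝ} (hc₁ : 0 ≤ c₁) {h h' : HiggsLattice.Site P 0 → ℝ}
    (hh : IsSmoothLoc k c₁ c₂ α S h) (hh' : IsSmoothLoc k c₁ c₂ α S' h') {BV : ℝ} (hBV : 0 ≤ BV)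
    (bY : ∀ x ∈ S, ∀ y ∈ S', ‖KV x y‖ ≤ BV) (bX : ∀ x ∈ S, ∀ y ∈ S', ∀ μ : Fin P.d, ‖KD ⟨x, μ⟩ y‖ ≤ BV)
    (bY' : ∀ x ∈ S', ∀ y ∈ S, ‖KV x y‖ ≤ BV) (bX' : ∀ x ∈ S', ∀ y ∈ S, ∀ μ : Fin P.d, ‖KD ⟨x, μ⟩ y‖ ≤ BV) (c : PBd P) :
    ‖derivM k KV KD h h' c‖ ≤ (1 + c₁) * BV := by
  rcases c with ⟨μ, x, x'⟩ | ⟨ν, x, x'⟩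
  · rw [derivM_inl]
    exact norm_derivM_core hc₁ hh hh' hBV bY bX x x' μ
  · rw [derivM_inr]
    exact norm_derivM_core hc₁ hh' hh hBV bY' bX' x' x ν

/-- **The Hölder quotients of `D^ηG` over same-direction product bonds at positive distance**, from the core estimate on the pair of domains seen
from the bond (`(S, S′)` for row pairs, `(S′, S)` for column pairs). [cite: Balaban1983Higgs3, (1.32) p.420] [cite: Balaban1983Higgs3, (2.5) p.424, (3.1) p.432] -/
theorem holder_mulM_le {S S' : Finset (HiggsLattice.Site P 0)}
    (hdiam : ∀ y₁ ∈ S, ∀ y₂ ∈ S, (HiggsLattice.Site.tdist y₁ y₂ : ℝ) / (P.L : ℝ) ^ k ≤ m)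
    (hdiam' : ∀ y₁ ∈ S', ∀ y₂ ∈ S', (HiggsLattice.Site.tdist y₁ y₂ : ℝ) / (P.L : ℝ) ^ k ≤ m)
    {c₁ c₂ α : ℝ} (hc₁ : 0 ≤ c₁) (hc₂ : 0 ≤ c₂) (hα0 : 0 ≤ α) (hα1 : α ≤ 1) {h h' : HiggsLattice.Site P 0 → ℝ}
    (hh : IsSmoothLoc k c₁ c₂ α S h) (hh' : IsSmoothLoc k c₁ c₂ α S' h') {BV BH : ℝ} (hBV : 0 ≤ BV) (hBH : 0 ≤ BH)
    (bY : ∀ x ∈ S, ∀ y ∈ S', ‖KV x y‖ ≤ BV)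
    (bX : ∀ x ∈ S, ∀ y ∈ S', ∀ μ : Fin P.d, ‖KD ⟨x, μ⟩ y‖ ≤ BV)
    (bH : ∀ (μ : Fin P.d) (x₁ x₂ y₁ y₂ : HiggsLattice.Site P 0), x₁ ∈ S → x₂ ∈ S → y₁ ∈ S' → y₂ ∈ S' →
      0 < max (HiggsLattice.Site.tdist x₁ x₂ : ℝ) (HiggsLattice.Site.tdist y₁ y₂ : ℝ) / (P.L : ℝ) ^ k →
      ‖(hol C A x₁ (cpath x₁ x₂)).comp ((KD ⟨x₂, μ⟩ y₂).comp (star (hol C A y₁ (cpath y₁ y₂)))) - KD ⟨x₁, μ⟩ y₁‖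
        ≤ BH * (max (HiggsLattice.Site.tdist x₁ x₂ : ℝ) (HiggsLattice.Site.tdist y₁ y₂ : ℝ) / (P.L : ℝ) ^ k) ^ α)
    (bM : ∀ (x₁ x₂ y₁ y₂ : HiggsLattice.Site P 0), x₁ ∈ S → x₂ ∈ S → y₁ ∈ S' → y₂ ∈ S' →
      ‖(hol C A x₁ (cpath x₁ x₂)).comp ((KV x₂ y₂).comp (star (hol C A y₁ (cpath y₁ y₂)))) - KV x₁ y₁‖
        ≤ (P.d : ℝ) * (((HiggsLattice.Site.tdist x₁ x₂ : ℝ) + (HiggsLattice.Site.tdist y₁ y₂ : ℝ)) / (P.L : ℝ) ^ k) * BV)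
    (bY' : ∀ x ∈ S', ∀ y ∈ S, ‖KV x y‖ ≤ BV)
    (bX' : ∀ x ∈ S', ∀ y ∈ S, ∀ μ : Fin P.d, ‖KD ⟨x, μ⟩ y‖ ≤ BV)
    (bH' : ∀ (μ : Fin P.d) (x₁ x₂ y₁ y₂ : HiggsLattice.Site P 0), x₁ ∈ S' → x₂ ∈ S' → y₁ ∈ S → y₂ ∈ S →
      0 < max (HiggsLattice.Site.tdist x₁ x₂ : ℝ) (HiggsLattice.Site.tdist y₁ y₂ : ℝ) / (P.L : ℝ) ^ k →
      ‖(hol C A x₁ (cpath x₁ x₂)).comp ((KD ⟨x₂, μ⟩ y₂).comp (star (hol C A y₁ (cpath y₁ y₂)))) - KD ⟨x₁, μ⟩ y₁‖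
        ≤ BH * (max (HiggsLattice.Site.tdist x₁ x₂ : ℝ) (HiggsLattice.Site.tdist y₁ y₂ : ℝ) / (P.L : ℝ) ^ k) ^ α)
    (bM' : ∀ (x₁ x₂ y₁ y₂ : HiggsLattice.Site P 0), x₁ ∈ S' → x₂ ∈ S' → y₁ ∈ S → y₂ ∈ S →
      ‖(hol C A x₁ (cpath x₁ x₂)).comp ((KV x₂ y₂).comp (star (hol C A y₁ (cpath y₁ y₂)))) - KV x₁ y₁‖
        ≤ (P.d : ℝ) * (((HiggsLattice.Site.tdist x₁ x₂ : ℝ) + (HiggsLattice.Site.tdist y₁ y₂ : ℝ)) / (P.L : ℝ) ^ k) * BV)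
    {c c' : PBd P} (hdir : dirOf c = dirOf c') (hpos : 0 < pdist k (baseOf c) (baseOf c')) :
    ‖transp C A c c' (derivM k KV KD h h' c') - derivM k KV KD h h' c‖
      ≤ (BH + ((2 * P.d * c₁ + 2) + 2 * P.d * m * c₁ + (c₂ + P.d * c₁ * c₁ + 2 * c₁)) * BV)
          * pdist k (baseOf c) (baseOf c') ^ α := by
  rcases c with ⟨μ, x₁, y₁⟩ | ⟨μ, y₁, x₁⟩ <;> rcases c' with ⟨μ', x₂, y₂⟩ | ⟨μ', y₂, x₂⟩ <;>
    simp only [dirOf, Sum.elim_inl, Sum.elim_inr, Sum.inl.injEq, Sum.inr.injEq, reduceCtorEq] at hdir <;> subst hdir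
  · rw [derivM_inl, derivM_inl]
    simp only [transp, hb, Sum.elim_inl, pdist, baseOf]
    exact holder_core_mulG hdiam hdiam' hc₁ hc₂ hα0 hα1 hh hh' hBV hBH bY bX bH bM μ hpos
  · rw [derivM_inr, derivM_inr]
    simp only [transp, hb, Sum.elim_inr, pdist, baseOf]
    change 0 < max (HiggsLattice.Site.tdist y₁ y₂ : ℝ) (HiggsLattice.Site.tdist x₁ x₂ : ℝ) / (P.L : ℝ) ^ k at hpos
    rw [max_comm] at hpos
    have hres := holder_core_mulG hdiam' hdiam hc₁ hc₂ hα0 hα1 hh' hh hBV hBH bY' bX' bH' bM' μ hpos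
    rw [max_comm]
    exact hres

/-- **`‖(h ⊗ h′)F‖_{1,α} ≤ K(c₁,c₂,d,m)·B + B_H` ON THE WHOLE PRODUCT LATTICE for smooth localization functions `h, h′` supported (with collar)
in two domains `S, S′` of diameter `≤ mL^k`, given the EIGHT block bounds** — values and derivatives `≤ B`, transported Hölder differences of the
derivative blocks `≤ B_H·p^α`, transported value moves `≤ d(|Δx| + |Δy|)/L^k·B`, on `(S, S′)` and on `(S′, S)` —, with p40's
`K = smoothConst d m c₁ c₂ = 2 + c₁ + (2dc₁ + 2) + 2dmc₁ + (c₂ + dc₁² + 2c₁)` (sup parts `1 + (1 + c₁)`, Hölder part: the moduli of `a`, the value moves,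
the moduli of `b`). [cite: Balaban1983Higgs3, (1.32) p.420] [cite: Balaban1983Higgs3, p.420] [cite: Balaban1983Higgs3, (2.5) p.424, (3.1) p.432] -/
theorem normM_le {S S' : Finset (HiggsLattice.Site P 0)}
    (hdiam : ∀ y₁ ∈ S, ∀ y₂ ∈ S, (HiggsLattice.Site.tdist y₁ y₂ : ℝ) / (P.L : ℝ) ^ k ≤ m)
    (hdiam' : ∀ y₁ ∈ S', ∀ y₂ ∈ S', (HiggsLattice.Site.tdist y₁ y₂ : ℝ) / (P.L : ℝ) ^ k ≤ m)
    {c₁ c₂ α : ℝ} (hc₁ : 0 ≤ c₁) (hc₂ : 0 ≤ c₂) (hα0 : 0 ≤ α) (hα1 : α ≤ 1) {h h' : HiggsLattice.Site P 0 → ℝ}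
    (hh : IsSmoothLoc k c₁ c₂ α S h) (hh' : IsSmoothLoc k c₁ c₂ α S' h') {BV BH : ℝ} (hBV : 0 ≤ BV) (hBH : 0 ≤ BH)
    (bY : ∀ x ∈ S, ∀ y ∈ S', ‖KV x y‖ ≤ BV)
    (bX : ∀ x ∈ S, ∀ y ∈ S', ∀ μ : Fin P.d, ‖KD ⟨x, μ⟩ y‖ ≤ BV)
    (bH : ∀ (μ : Fin P.d) (x₁ x₂ y₁ y₂ : HiggsLattice.Site P 0), x₁ ∈ S → x₂ ∈ S → y₁ ∈ S' → y₂ ∈ S' →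
      0 < max (HiggsLattice.Site.tdist x₁ x₂ : ℝ) (HiggsLattice.Site.tdist y₁ y₂ : ℝ) / (P.L : ℝ) ^ k →
      ‖(hol C A x₁ (cpath x₁ x₂)).comp ((KD ⟨x₂, μ⟩ y₂).comp (star (hol C A y₁ (cpath y₁ y₂)))) - KD ⟨x₁, μ⟩ y₁‖
        ≤ BH * (max (HiggsLattice.Site.tdist x₁ x₂ : ℝ) (HiggsLattice.Site.tdist y₁ y₂ : ℝ) / (P.L : ℝ) ^ k) ^ α)
    (bM : ∀ (x₁ x₂ y₁ y₂ : HiggsLattice.Site P 0), x₁ ∈ S → x₂ ∈ S → y₁ ∈ S' → y₂ ∈ S' →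
      ‖(hol C A x₁ (cpath x₁ x₂)).comp ((KV x₂ y₂).comp (star (hol C A y₁ (cpath y₁ y₂)))) - KV x₁ y₁‖
        ≤ (P.d : ℝ) * (((HiggsLattice.Site.tdist x₁ x₂ : ℝ) + (HiggsLattice.Site.tdist y₁ y₂ : ℝ)) / (P.L : ℝ) ^ k) * BV)
    (bY' : ∀ x ∈ S', ∀ y ∈ S, ‖KV x y‖ ≤ BV)
    (bX' : ∀ x ∈ S', ∀ y ∈ S, ∀ μ : Fin P.d, ‖KD ⟨x, μ⟩ y‖ ≤ BV)
    (bH' : ∀ (μ : Fin P.d) (x₁ x₂ y₁ y₂ : HiggsLattice.Site P 0), x₁ ∈ S' → x₂ ∈ S' → y₁ ∈ S → y₂ ∈ S →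
      0 < max (HiggsLattice.Site.tdist x₁ x₂ : ℝ) (HiggsLattice.Site.tdist y₁ y₂ : ℝ) / (P.L : ℝ) ^ k →
      ‖(hol C A x₁ (cpath x₁ x₂)).comp ((KD ⟨x₂, μ⟩ y₂).comp (star (hol C A y₁ (cpath y₁ y₂)))) - KD ⟨x₁, μ⟩ y₁‖
        ≤ BH * (max (HiggsLattice.Site.tdist x₁ x₂ : ℝ) (HiggsLattice.Site.tdist y₁ y₂ : ℝ) / (P.L : ℝ) ^ k) ^ α)
    (bM' : ∀ (x₁ x₂ y₁ y₂ : HiggsLattice.Site P 0), x₁ ∈ S' → x₂ ∈ S' → y₁ ∈ S → y₂ ∈ S →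
      ‖(hol C A x₁ (cpath x₁ x₂)).comp ((KV x₂ y₂).comp (star (hol C A y₁ (cpath y₁ y₂)))) - KV x₁ y₁‖
        ≤ (P.d : ℝ) * (((HiggsLattice.Site.tdist x₁ x₂ : ℝ) + (HiggsLattice.Site.tdist y₁ y₂ : ℝ)) / (P.L : ℝ) ^ k) * BV) :
    normM C A k KV KD α h h' ≤ smoothConst P.d m c₁ c₂ * BV + BH := by
  have h1 : LatticeNorms.supNorm Finset.univ (kerM KV h h') ≤ BV := supNorm_le hBV fun z _ => norm_kerM_le hh hh' hBV bY z
  have h2 : LatticeNorms.supNorm Finset.univ (derivM k KV KD h h') ≤ (1 + c₁) * BV :=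
    supNorm_le (by positivity) fun c _ => norm_derivM_le hc₁ hh hh' hBV bY bX bY' bX' c
  have h3 : LatticeNorms.holderSeminorm α (fun c c' : PBd P => dirOf c = dirOf c') (fun c c' => pdist k (baseOf c) (baseOf c'))
      (transp C A) Finset.univ (derivM k KV KD h h')
      ≤ BH + ((2 * P.d * c₁ + 2) + 2 * P.d * m * c₁ + (c₂ + P.d * c₁ * c₁ + 2 * c₁)) * BV :=
    holderSeminorm_le (by positivity) fun c _ c' _ hdir hpos =>
      holder_mulM_le hdiam hdiam' hc₁ hc₂ hα0 hα1 hh hh' hBV hBH bY bX bH bM bY' bX' bH' bM' hdir hpos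
  rw [normM, norm132]
  calc _ ≤ BV + (1 + c₁) * BV + (BH + ((2 * P.d * c₁ + 2) + 2 * P.d * m * c₁ + (c₂ + P.d * c₁ * c₁ + 2 * c₁)) * BV) :=
        add_le_add (add_le_add h1 h2) h3
    _ = _ := by unfold smoothConst; ring

/-- `K(c₁,c₂,d,m) > 0` (re-export of p40's positivity for the users of `normM_le`). [cite: Balaban1983Higgs3, (1.32) p.420] -/
theorem smoothConst_pos' (d m : ℕ) {c₁ c₂ : ℝ} (hc₁ : 0 ≤ c₁) (hc₂ : 0 ≤ c₂) : 0 < smoothConst d m c₁ c₂ :=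
  smoothConst_pos d m hc₁ hc₂

end Product

end Literature.MathematicalPhysics.QuantumFieldTheory.Balaban1983to89.B3Norm132SmoothMultiplier

end
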